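import Literature.Geometry.Lorentzian.InitialDataPullback
import Literature.Geometry.Lorentzian.ModelData
import Literature.Geometry.Riemannian.RiemannianDistance
import Literature.Geometry.Manifold.InjOnLocalDiffeomorphInverse
import Literature.Geometry.Manifold.OpenSubmanifoldMFDeriv
import Mathlib.Geometry.Manifold.Riemannian.Basic
import Mathlib.MeasureTheory.Integral.IntervalIntegral.ContDiff
import HarnessLib

/-!
# Crux `StarvedNecks.HonestFixedRadiusSettling` (stmt-FinalStateConjecture-13550), line `far-field-surgery`
# (sheet burial), stub `stub_sheetProper`: SHEET SHIELDS ARE PROPER AT INFINITY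

A SHEET SHIELD of a datum `D` on the `3`-manifold `X` is a smooth open embedding
`Φ : {‖y‖ > M'/2} → X` with injective differentials along which `D` pulls back EXACTLY to the
time-symmetric isotropic Schwarzschild exterior data `((1 + M'/2‖y‖)⁴ δ, 0)`.  We prove that
`Φ(y)` leaves every compact subset of `X` as `‖y‖ → ∞` (`stub_sheetProper`).

Proof (Riemannian distance, no volume, no completeness).  Let `d` be the Riemannian distance of
the data metric `h` (`PseudoRiemannianMetric.edist`, `Literature/Geometry/Riemannian/RiemannianDistance.lean`;
its balls form a neighbourhood basis).  The range `W` of `Φ` is open and the inverse `Ψ` of `Φ` is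
smooth on `W` (inverse function theorem, `contMDiffOn_invFunOn_of_bijective_mfderiv`).  KEY LEMMA
(`setOf_edist_lt_subset_range`): if the closed Euclidean ball `B̄(y, ρ)` lies in the sheet then the
`d`-ball of radius `ρ` about `Φ y` lies in `W` — a `C¹` path from `Φ y` of `h`-length `< ρ` cannot
leave `W`: as long as it stays in `W` its pull-back `Ψ ∘ γ` has Euclidean speed at most its
`h`-speed (`Φ^* h = (1 + M'/2‖y‖)⁴ δ ≥ δ`), hence stays in `B̄(y, ρ)`, whose `Φ`-image is compact,
so the first exit point would lie in that compact subset of `W`.  Now if the far points `Φ(yₙ)`,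
`‖yₙ‖ → ∞`, cluster at `k`, then some far `Φ(yₙ)` is `d`-close to `k`, so `k ∈ W`, `k = Φ y⋆`, and
the `yₙ` cluster at `y⋆` because `Φ` is an embedding — contradiction.
-/

set_option linter.dupNamespace false

noncomputable section

namespace Summit.FinalStateConjecture.FinalStateConjecture.Theorems.StarvedNecks.SheetBurial

open scoped Manifold ContDiff Topology
open Set Filter Function MeasureTheory Literature.Geometry.Lorentzian
open Literature.Geometry.Manifold

section Sheet

variable {X : Type} [TopologicalSpace X] [ChartedSpace E3 X] [IsManifold (𝓡 3) ∞ X]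
  {M' : ℝ} {Φ : Schwarzschild.isotropicExterior M' → X}

omit [IsManifold (𝓡 3) ∞ X] in
/-- An injective differential of a sheet chart is bijective (both tangent spaces are `E3`). -/
theorem bijective_mfderiv_of_injective (hΦ' : ∀ u, Function.Injective (mfderiv (𝓡 3) (𝓡 3) Φ u))
    (u : Schwarzschild.isotropicExterior M') : Function.Bijective (mfderiv (𝓡 3) (𝓡 3) Φ u) := by
  refine ⟨hΦ' u, ?_⟩
  haveI : FiniteDimensional ℝ (TangentSpace (𝓡 3) u) := inferInstanceAs (FiniteDimensional ℝ E3)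
  haveI : FiniteDimensional ℝ (TangentSpace (𝓡 3) (Φ u)) := inferInstanceAs (FiniteDimensional ℝ E3)
  exact (LinearMap.injective_iff_surjective_of_finrank_eq_finrank rfl).1 (hΦ' u)

/-- **The pulled-back metric dominates the Euclidean metric**: along a sheet shield,
`h(dΦ v, dΦ v) = (1 + M'/2‖u‖)⁴ ‖v‖² ≥ ‖v‖²`. -/
theorem norm_sq_le_h_mfderiv {D : InitialDataSet (𝓡 3) X} (hM' : 0 < M')
    {hΦ : ContMDiff (𝓡 3) (𝓡 3) (∞ + 1) Φ} {hΦ' : ∀ u, Function.Injective (mfderiv (𝓡 3) (𝓡 3) Φ u)}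
    (hdata : D.comap Φ hΦ hΦ' = Schwarzschild.timeSymmetricExteriorData M' hM'.le)
    (u : Schwarzschild.isotropicExterior M') (v : E3) :
    ‖v‖ ^ 2 ≤ D.h.inner (Φ u) (mfderiv (𝓡 3) (𝓡 3) Φ u v) (mfderiv (𝓡 3) (𝓡 3) Φ u v) := by
  have h1 : (D.comap Φ hΦ hΦ').h.inner u v v =
      D.h.inner (Φ u) (mfderiv (𝓡 3) (𝓡 3) Φ u v) (mfderiv (𝓡 3) (𝓡 3) Φ u v) :=
    InitialDataSet.comap_h_inner D hΦ hΦ' u v v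
  rw [← h1, hdata, Schwarzschild.timeSymmetricExteriorData_h_inner, real_inner_self_eq_norm_sq]
  have h2 : 1 ≤ Schwarzschild.conformalFactor M' (u : E3) ^ 4 :=
    one_le_pow₀ (Schwarzschild.one_le_conformalFactor hM'.le _)
  nlinarith [sq_nonneg ‖v‖]

/-- **Calculus of the pulled-back path.**  Let `Ψ = invFunOn Φ univ` be the inverse of the sheet
shield on its open range.  If a curve `γ` in `X` is differentiable at `s` with `γ s` in the range,
then the Euclidean path `t ↦ ↑(Ψ (γ t))` has derivative `u := dΨ(γ̇ s)` at `s`, and `dΦ u = γ̇ s`. -/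
theorem hasDerivAt_val_invFunOn_comp
    (hΦ : ContMDiff (𝓡 3) (𝓡 3) (∞ + 1) Φ) (hΦ' : ∀ u, Function.Injective (mfderiv (𝓡 3) (𝓡 3) Φ u))
    (hopen : Topology.IsOpenEmbedding Φ) {γ : ℝ → X} {s : ℝ}
    (hγd : MDifferentiableAt 𝓘(ℝ, ℝ) (𝓡 3) γ s) (hγs : γ s ∈ Set.range Φ) :
    HasDerivAt (fun t ↦ ((invFunOn Φ univ (γ t) : Schwarzschild.isotropicExterior M') : E3))
        (@id E3 (mfderiv (𝓡 3) (𝓡 3) (invFunOn Φ univ) (γ s) (mfderiv 𝓘(ℝ, ℝ) (𝓡 3) γ s 1))) s ∧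
      mfderiv (𝓡 3) (𝓡 3) Φ (invFunOn Φ univ (γ s))
          (mfderiv (𝓡 3) (𝓡 3) (invFunOn Φ univ) (γ s) (mfderiv 𝓘(ℝ, ℝ) (𝓡 3) γ s 1)) =
        mfderiv 𝓘(ℝ, ℝ) (𝓡 3) γ s 1 := by
  obtain ⟨y₀, -⟩ := id hγs
  haveI : Nonempty (Schwarzschild.isotropicExterior M') := ⟨y₀⟩
  have hW : IsOpen (Set.range Φ) := hopen.isOpen_range
  have hΦs : ContMDiffOn (𝓡 3) (𝓡 3) ∞ Φ univ := (hΦ.of_le le_self_add).contMDiffOn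
  have hinj : InjOn Φ univ := hopen.injective.injOn
  have hbij : ∀ u ∈ (univ : Set (Schwarzschild.isotropicExterior M')),
      Function.Bijective (mfderiv (𝓡 3) (𝓡 3) Φ u) := fun u _ ↦ bijective_mfderiv_of_injective hΦ' u
  set Ψ : X → Schwarzschild.isotropicExterior M' := invFunOn Φ univ with hΨ_def
  have hΨs : ContMDiffOn (𝓡 3) (𝓡 3) ∞ Ψ (Set.range Φ) := by
    rw [← image_univ]
    exact contMDiffOn_invFunOn_of_bijective_mfderiv isOpen_univ hΦs hinj hbij
  have hΦΨ : Φ (Ψ (γ s)) = γ s := apply_invFunOn (by rwa [image_univ])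
  have hΨd : MDifferentiableAt (𝓡 3) (𝓡 3) Ψ (γ s) :=
    (hΨs.contMDiffAt (hW.mem_nhds hγs)).mdifferentiableAt (by simp)
  have hvd : HasMFDerivAt (𝓡 3) 𝓘(ℝ, E3) (Subtype.val : Schwarzschild.isotropicExterior M' → E3) (Ψ (γ s))
      (ContinuousLinearMap.id ℝ E3) := OpenSubmanifold.hasMFDerivAt_subtype_val _
  have hcomp : HasMFDerivAt 𝓘(ℝ, ℝ) 𝓘(ℝ, E3)
      (fun t ↦ ((Ψ (γ t) : Schwarzschild.isotropicExterior M') : E3)) s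
      ((ContinuousLinearMap.id ℝ E3).comp ((mfderiv (𝓡 3) (𝓡 3) Ψ (γ s)).comp
        (mfderiv 𝓘(ℝ, ℝ) (𝓡 3) γ s))) :=
    hvd.comp s (hΨd.hasMFDerivAt.comp s hγd.hasMFDerivAt)
  refine ⟨?_, ?_⟩
  · have h2 : HasFDerivAt (𝕜 := ℝ) (fun t ↦ ((Ψ (γ t) : Schwarzschild.isotropicExterior M') : E3))
        (((ContinuousLinearMap.id ℝ E3).comp ((mfderiv (𝓡 3) (𝓡 3) Ψ (γ s)).comp
          (mfderiv 𝓘(ℝ, ℝ) (𝓡 3) γ s))) : ℝ →L[ℝ] E3) s := hcomp.hasFDerivAt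
    exact h2.hasDerivAt
  · have h := mfderiv_comp_mfderiv_invFunOn isOpen_univ hΦs hinj hbij (mem_univ (Ψ (γ s)))
      (mfderiv 𝓘(ℝ, ℝ) (𝓡 3) γ s 1)
    rw [hΦΨ] at h
    exact h

open Bundle in
/-- **KEY LEMMA — Riemannian balls about far sheet points stay in the range.**  If the closed
Euclidean ball `B̄(y, ρ)` lies in the sheet, the `d_h`-ball of radius `ρ` about `Φ y` lies in the
(open) range of `Φ`. -/
theorem setOf_edist_lt_subset_range [T2Space X] (D : InitialDataSet (𝓡 3) X) (hM' : 0 < M')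
    (hΦ : ContMDiff (𝓡 3) (𝓡 3) (∞ + 1) Φ) (hΦ' : ∀ u, Function.Injective (mfderiv (𝓡 3) (𝓡 3) Φ u))
    (hopen : Topology.IsOpenEmbedding Φ)
    (hdata : D.comap Φ hΦ hΦ' = Schwarzschild.timeSymmetricExteriorData M' hM'.le)
    (y : Schwarzschild.isotropicExterior M') {ρ : ℝ} (hρ : 0 < ρ)
    (hball : Metric.closedBall (y : E3) ρ ⊆ (Schwarzschild.isotropicExterior M' : Set E3)) :
    {x | D.metric.edist D.isRiemannian_metric (Φ y) x < ENNReal.ofReal ρ} ⊆ Set.range Φ := by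
  have hg : D.metric.IsRiemannian := D.isRiemannian_metric
  letI := D.metric.riemannianBundle hg
  haveI : Nonempty (Schwarzschild.isotropicExterior M') := ⟨y⟩
  have hW : IsOpen (Set.range Φ) := hopen.isOpen_range
  have hΦs : ContMDiffOn (𝓡 3) (𝓡 3) ∞ Φ univ := (hΦ.of_le le_self_add).contMDiffOn
  have hinj : InjOn Φ univ := hopen.injective.injOn
  have hbij : ∀ u ∈ (univ : Set (Schwarzschild.isotropicExterior M')),
      Function.Bijective (mfderiv (𝓡 3) (𝓡 3) Φ u) := fun u _ ↦ bijective_mfderiv_of_injective hΦ' u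
  set Ψ : X → Schwarzschild.isotropicExterior M' := invFunOn Φ univ with hΨ_def
  have hΨs : ContMDiffOn (𝓡 3) (𝓡 3) ∞ Ψ (Set.range Φ) := by
    rw [← image_univ]
    exact contMDiffOn_invFunOn_of_bijective_mfderiv isOpen_univ hΦs hinj hbij
  have hΨΦ : ∀ u : Schwarzschild.isotropicExterior M', Ψ (Φ u) = u := fun u ↦
    invFunOn_apply hinj (mem_univ u)
  have hΦΨ : ∀ x ∈ Set.range Φ, Φ (Ψ x) = x := fun x hx ↦ apply_invFunOn (by rwa [image_univ])
  -- a point at distance `< ρ` and a short path to it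
  intro x hx
  have hx' : Manifold.riemannianEDist (𝓡 3) (Φ y) x < ENNReal.ofReal ρ := hx
  obtain ⟨γ, hγ0, hγ1, hγs, hγL⟩ := Manifold.exists_lt_of_riemannianEDist_lt hx'
  -- the set of exit parameters is empty
  set S : Set ℝ := Icc (0 : ℝ) 1 ∩ γ ⁻¹' (Set.range Φ)ᶜ with hS
  have hγc : ContinuousOn γ (Icc 0 1) := hγs.continuousOn
  have hSc : IsClosed S := hγc.preimage_isClosed_of_isClosed isClosed_Icc hW.isClosed_compl
  by_cases hSe : S = ∅
  · have h1 : (1 : ℝ) ∉ S := by rw [hSe]; exact notMem_empty _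
    have : γ 1 ∈ Set.range Φ := by
      by_contra hcon
      exact h1 ⟨⟨zero_le_one, le_rfl⟩, hcon⟩
    rwa [hγ1] at this
  exfalso
  have hSne : S.Nonempty := nonempty_iff_ne_empty.2 hSe
  have hSbdd : BddBelow S := ⟨0, fun t ht ↦ ht.1.1⟩
  set t₁ := sInf S with ht₁
  have ht₁S : t₁ ∈ S := hSc.csInf_mem hSne hSbdd
  have ht₁0 : 0 < t₁ := by
    rcases ht₁S.1.1.eq_or_lt with h | h
    · exfalso
      have : γ 0 ∈ Set.range Φ := by rw [hγ0]; exact ⟨y, rfl⟩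
      exact ht₁S.2 (h ▸ this)
    · exact h
  have ht₁1 : t₁ ≤ 1 := ht₁S.1.2
  have hbefore : ∀ t, 0 ≤ t → t < t₁ → γ t ∈ Set.range Φ := by
    intro t ht0 htt
    by_contra hcon
    have htS : t ∈ S := ⟨⟨ht0, htt.le.trans ht₁1⟩, hcon⟩
    exact absurd (csInf_le hSbdd htS) (not_le.2 htt)
  -- the pull-back path and its Euclidean speed
  set w : ℝ → E3 := fun t ↦ ((Ψ (γ t) : Schwarzschild.isotropicExterior M') : E3) with hw
  have hw0 : w 0 = y := by simp only [hw, hγ0, hΨΦ]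
  have hderiv : ∀ s, 0 < s → s < t₁ →
      ∃ u : E3, HasDerivAt w u s ∧ ‖u‖ ≤ ‖mfderiv 𝓘(ℝ, ℝ) (𝓡 3) γ s 1‖ := by
    intro s hs0 hst
    have hs1 : s < 1 := hst.trans_le ht₁1
    have hγW : γ s ∈ Set.range Φ := hbefore s hs0.le hst
    have hγd : MDifferentiableAt 𝓘(ℝ, ℝ) (𝓡 3) γ s :=
      (hγs.contMDiffAt (Icc_mem_nhds hs0 hs1)).mdifferentiableAt one_ne_zero
    obtain ⟨hd, hkey⟩ := hasDerivAt_val_invFunOn_comp hΦ hΦ' hopen hγd hγW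
    refine ⟨_, hd, ?_⟩
    set u : E3 := @id E3 (mfderiv (𝓡 3) (𝓡 3) Ψ (γ s) (mfderiv 𝓘(ℝ, ℝ) (𝓡 3) γ s 1)) with hu
    have hp : Φ (Ψ (γ s)) = γ s := hΦΨ _ hγW
    have hsq : ‖u‖ ^ 2 ≤
        D.metric.val (γ s) (mfderiv 𝓘(ℝ, ℝ) (𝓡 3) γ s 1) (mfderiv 𝓘(ℝ, ℝ) (𝓡 3) γ s 1) := by
      have h := norm_sq_le_h_mfderiv hM' hdata (Ψ (γ s)) u
      have hk : mfderiv (𝓡 3) (𝓡 3) Φ (Ψ (γ s)) u = mfderiv 𝓘(ℝ, ℝ) (𝓡 3) γ s 1 := hkey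
      rw [hk] at h
      rw [InitialDataSet.val_metric]
      have h' : D.h.inner (Φ (Ψ (γ s))) (mfderiv 𝓘(ℝ, ℝ) (𝓡 3) γ s 1) (mfderiv 𝓘(ℝ, ℝ) (𝓡 3) γ s 1) =
          D.h.inner (γ s) (mfderiv 𝓘(ℝ, ℝ) (𝓡 3) γ s 1) (mfderiv 𝓘(ℝ, ℝ) (𝓡 3) γ s 1) := by
        rw [hp]
      rw [h'] at h
      exact h
    have hnorm : ‖mfderiv 𝓘(ℝ, ℝ) (𝓡 3) γ s 1‖ =
        Real.sqrt (D.metric.val (γ s) (mfderiv 𝓘(ℝ, ℝ) (𝓡 3) γ s 1) (mfderiv 𝓘(ℝ, ℝ) (𝓡 3) γ s 1)) :=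
      D.metric.norm_eq_sqrt hg (γ s) _
    rw [hnorm]
    exact Real.le_sqrt_of_sq_le hsq
  -- hence the pull-back path stays within Euclidean distance `< ρ` of `y` before the exit
  have hdisp : ∀ t, 0 < t → t < t₁ → ‖w t - w 0‖ < ρ := by
    intro t ht0 htt
    have ht1 : t ≤ 1 := htt.le.trans ht₁1
    -- `w` is `C¹` on `[0, t]`
    have hwc : ContDiffOn ℝ 1 w (Icc 0 t) := by
      have h1 : ContMDiffOn 𝓘(ℝ, ℝ) 𝓘(ℝ, E3) 1 w (Icc 0 t) := by
        have hγ' : ContMDiffOn 𝓘(ℝ, ℝ) (𝓡 3) 1 γ (Icc 0 t) := hγs.mono (Icc_subset_Icc_right ht1)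
        have hmaps : MapsTo γ (Icc 0 t) (Set.range Φ) := fun s hs ↦
          hbefore s hs.1 (hs.2.trans_lt htt)
        have hΨ1 : ContMDiffOn (𝓡 3) (𝓡 3) 1 Ψ (Set.range Φ) := hΨs.of_le (by simp)
        have hval : ContMDiff (𝓡 3) 𝓘(ℝ, E3) 1
            (Subtype.val : Schwarzschild.isotropicExterior M' → E3) := contMDiff_subtype_val
        exact hval.comp_contMDiffOn (hΨ1.comp hγ' hmaps)
      exact contMDiffOn_iff_contDiffOn.1 h1
    have hmain := enorm_sub_le_lintegral_derivWithin_Icc_of_contDiffOn_Icc hwc ht0.le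
    -- compare the integrands on `(0, t)`
    have hle : ∫⁻ s in Icc 0 t, ‖derivWithin w (Icc 0 t) s‖ₑ ≤
        ∫⁻ s in Icc 0 t, ‖mfderiv 𝓘(ℝ, ℝ) (𝓡 3) γ s 1‖ₑ := by
      rw [← restrict_Ioo_eq_restrict_Icc]
      refine setLIntegral_mono' measurableSet_Ioo fun s hs ↦ ?_
      have hst : s < t₁ := hs.2.trans htt
      obtain ⟨u, hd, hb⟩ := hderiv s hs.1 hst
      have hdw : derivWithin w (Icc 0 t) s = deriv w s :=
        derivWithin_of_mem_nhds (Icc_mem_nhds hs.1 hs.2)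
      rw [hdw, hd.deriv, ← ofReal_norm, ← ofReal_norm]
      exact ENNReal.ofReal_le_ofReal hb
    have hlen : ∫⁻ s in Icc 0 t, ‖mfderiv 𝓘(ℝ, ℝ) (𝓡 3) γ s 1‖ₑ ≤ Manifold.pathELength (𝓡 3) γ 0 1 := by
      rw [Manifold.pathELength_eq_lintegral_mfderiv_Icc]
      exact lintegral_mono_set (Icc_subset_Icc_right ht1)
    have h := ((hmain.trans hle).trans hlen).trans_lt hγL
    rw [← ofReal_norm] at h
    exact (ENNReal.ofReal_lt_ofReal_iff hρ).1 h
  -- the compact set `Φ(B̄(y, ρ))` contains `γ t` for `0 ≤ t < t₁`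
  set Q : Set X := Φ '' ((Subtype.val : Schwarzschild.isotropicExterior M' → E3) ⁻¹'
    Metric.closedBall (y : E3) ρ) with hQ
  have hQc : IsCompact Q := by
    refine IsCompact.image ?_ hopen.continuous
    rw [Subtype.isCompact_iff]
    have : Subtype.val '' ((Subtype.val : Schwarzschild.isotropicExterior M' → E3) ⁻¹'
        Metric.closedBall (y : E3) ρ) = Metric.closedBall (y : E3) ρ := by
      rw [image_preimage_eq_inter_range, Subtype.range_coe]
      exact inter_eq_left.2 hball
    rw [this]
    exact isCompact_closedBall _ _
  have hQW : Q ⊆ Set.range Φ := by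
    rintro _ ⟨u, -, rfl⟩
    exact ⟨u, rfl⟩
  have hγQ : ∀ t, 0 ≤ t → t < t₁ → γ t ∈ Q := by
    intro t ht0 htt
    have hγW : γ t ∈ Set.range Φ := hbefore t ht0 htt
    refine ⟨Ψ (γ t), ?_, hΦΨ _ hγW⟩
    show (w t) ∈ Metric.closedBall (y : E3) ρ
    rw [Metric.mem_closedBall, dist_eq_norm, ← hw0]
    rcases ht0.eq_or_lt with h | h
    · rw [← h, sub_self, norm_zero]; exact hρ.le
    · exact (hdisp t h htt).le
  -- so the exit point lies in `Q ⊆ range Φ`: contradiction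
  have hmem : γ t₁ ∈ Q := by
    have hcw : ContinuousWithinAt γ (Ico 0 t₁) t₁ :=
      (hγc.continuousWithinAt ⟨ht₁0.le, ht₁1⟩).mono (Ico_subset_Icc_self.trans (Icc_subset_Icc_right ht₁1))
    haveI : (𝓝[Ico 0 t₁] t₁).NeBot := by
      refine mem_closure_iff_nhdsWithin_neBot.1 ?_
      rw [closure_Ico ht₁0.ne]
      exact right_mem_Icc.2 ht₁0.le
    refine hQc.isClosed.mem_of_tendsto hcw ?_
    filter_upwards [self_mem_nhdsWithin] with t ht
    exact hγQ t ht.1 ht.2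
  exact ht₁S.2 (hQW hmem)

/-- **Stub 1 — `stub_sheetProper` (SHEET SHIELDS ARE PROPER AT INFINITY).**  If `Φ : {‖y‖ > M'/2} → X`
is a smooth open embedding with injective differentials along which the datum `D` pulls back EXACTLY
to the time-symmetric isotropic Schwarzschild exterior data (`Φ^* h = (1 + M'/2‖y‖)⁴ δ ≥ δ`), then
`Φ(y)` leaves every compact subset of `X` as `‖y‖ → ∞`.  Proof: far sheet points in a compact `K`
cluster at some `k ∈ K`; the unit Euclidean balls about far points lie in the sheet, so a far point
`d_h`-close to `k` puts `k` in the range (`setOf_edist_lt_subset_range`), `k = Φ y⋆`, and then the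
far points cluster at `y⋆` in the sheet because `Φ` is an embedding — absurd. [folklore] -/
theorem stub_sheetProper :
    ∀ (X : Type) [TopologicalSpace X] [ChartedSpace E3 X] [IsManifold (𝓡 3) ∞ X] [T2Space X]
      (D : InitialDataSet (𝓡 3) X) (M' : ℝ) (hM' : 0 < M') (Φ : Schwarzschild.isotropicExterior M' → X)
      (hΦ : ContMDiff (𝓡 3) (𝓡 3) (∞ + 1) Φ) (hΦ' : ∀ u, Function.Injective (mfderiv (𝓡 3) (𝓡 3) Φ u)),
      Topology.IsOpenEmbedding Φ →
      D.comap Φ hΦ hΦ' = Schwarzschild.timeSymmetricExteriorData M' hM'.le →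
      ∀ K : Set X, IsCompact K →
        ∃ R' : ℝ, ∀ y : Schwarzschild.isotropicExterior M', R' < ‖(y : E3)‖ → Φ y ∉ K := by
  intro X _ _ _ _ D M' hM' Φ hΦ hΦ' hopen hdata K hK
  haveI : LocallyCompactSpace X := ChartedSpace.locallyCompactSpace E3 X
  have hg : D.metric.IsRiemannian := D.isRiemannian_metric
  by_contra hcon
  push Not at hcon
  -- far sheet points inside `K`, and a cluster point
  choose y hy using fun n : ℕ ↦ hcon ((n : ℝ) + M' + 1)
  have hfar : ∀ n : ℕ, (n : ℝ) + M' + 1 < ‖(y n : E3)‖ := fun n ↦ (hy n).1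
  obtain ⟨k, -, hk⟩ := hK.exists_clusterPt (f := map (fun n ↦ Φ (y n)) atTop)
    (le_principal_iff.2 (mem_map.2 (Eventually.of_forall fun n ↦ (hy n).2)))
  have hk' : ∀ U ∈ 𝓝 k, ∃ᶠ n in atTop, Φ (y n) ∈ U := mapClusterPt_iff_frequently.1 hk
  -- unit Euclidean balls about the far points lie in the sheet
  have hball : ∀ n, Metric.closedBall ((y n : E3)) 1 ⊆ (Schwarzschild.isotropicExterior M' : Set E3) := by
    intro n z hz
    rw [Metric.mem_closedBall, dist_eq_norm] at hz
    show M' / 2 < ‖z‖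
    have h1 : ‖(y n : E3)‖ ≤ ‖z‖ + ‖z - (y n : E3)‖ := by
      have := norm_add_le z ((y n : E3) - z)
      rw [add_sub_cancel] at this
      rwa [norm_sub_rev] at this
    have h2 := hfar n
    have h3 : (0 : ℝ) ≤ n := n.cast_nonneg
    linarith
  -- some far point is `d_h`-close to `k`, so `k` is in the range
  obtain ⟨n, hn⟩ := (hk' _ (PseudoRiemannianMetric.setOf_edist_lt_mem_nhds hg k
    (show (0 : ENNReal) < ENNReal.ofReal 1 by simp))).exists
  have hn' : D.metric.edist hg (Φ (y n)) k < ENNReal.ofReal 1 := by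
    rw [PseudoRiemannianMetric.edist_comm]; exact hn
  obtain ⟨ystar, hystar⟩ : k ∈ Set.range Φ :=
    setOf_edist_lt_subset_range D hM' hΦ hΦ' hopen hdata (y n) one_pos (hball n) hn'
  -- the far points cluster at `y⋆` in the sheet: absurd
  set V : Set X := Φ '' ((Subtype.val : Schwarzschild.isotropicExterior M' → E3) ⁻¹'
    Metric.ball (ystar : E3) 1) with hV
  have hVo : IsOpen V := hopen.isOpenMap _ (Metric.isOpen_ball.preimage continuous_subtype_val)
  have hkV : k ∈ V := ⟨ystar, by simp, hystar⟩
  have hfreq : ∃ᶠ m in atTop, ‖(y m : E3) - (ystar : E3)‖ < 1 := by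
    refine (hk' V (hVo.mem_nhds hkV)).mono fun m hm ↦ ?_
    obtain ⟨u, hu, hum⟩ := hm
    have : u = y m := hopen.injective hum
    subst this
    rwa [mem_preimage, Metric.mem_ball, dist_eq_norm] at hu
  have hev : ∀ᶠ m : ℕ in atTop, ‖(ystar : E3)‖ ≤ (m : ℝ) := by
    obtain ⟨N, hN⟩ := exists_nat_ge ‖(ystar : E3)‖
    filter_upwards [eventually_ge_atTop N] with m hm
    exact hN.trans (Nat.cast_le.2 hm)
  obtain ⟨m, hm1, hm2⟩ := (hfreq.and_eventually hev).exists
  have h1 : ‖(y m : E3)‖ ≤ ‖(ystar : E3)‖ + ‖(y m : E3) - (ystar : E3)‖ := by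
    have := norm_add_le (ystar : E3) ((y m : E3) - (ystar : E3))
    rwa [add_sub_cancel] at this
  have h2 := hfar m
  linarith

end Sheet

end Summit.FinalStateConjecture.FinalStateConjecture.Theorems.StarvedNecks.SheetBurial

end
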